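import Literature.MathematicalPhysics.QuantumFieldTheory.Balaban1983to89.B1Eq324BenfattoKernelRegression
import Literature.MathematicalPhysics.QuantumFieldTheory.Balaban1983to89.B1Eq324BenfattoCondKernelGeneric
import Literature.MathematicalPhysics.QuantumFieldTheory.Balaban1983to89.B1Eq324BenfattoTwoStageLaw
import HarnessLib

/-!
# `Balaban1983to89.B1Eq324BenfattoKernelCondField` — [BenfattoEtAl1978] p. 152 / Appendix C 2) p. 164 / §5 (5.13) p. 155 FOR A GENERAL
# COVARIANCE KERNEL: the conditioned field `P̂₀(dz|(z̄_Δ)_{Δ∈C})` of the Gaussian field of `K` AS A MEASURE — Gaussian with centre `u_C(z̄)`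
# and covariance `C^C`, the factorisation over regions where `C^C` vanishes, the tower identity (5.13) and the two-stage disintegration, PROVED

statement-level skeleton of published theorems with citation tags; proofs where landed; nothing here is a claim about the
Yang–Mills mass gap

WHY THIS MODULE (cell `pub-ymgap`, seat `dag-n08-d` gen 11, INTENT-46; node N08 [Balaban1985UV3]; the [BenfattoEtAl1978] source chain behind
the (α)-row `h324`).  Sequel of `…B1Eq324BenfattoKernelRegression` (n08-d: `C^C` of a general kernel is a PSD kernel) and
`…B1Eq324BenfattoCondKernelGeneric` (n08-c: strict positivity and the two-stage identities for a general kernel) — the regression ALGEBRA.  The measure-level facts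
about the conditioned field that every step of §5 uses — print's *"the conditioned variables (z_Δ)_{Δ∉Γ} are a non centered gaussian field
with covariance C^Γ_{ΔΔ′} … and center u_Δ"* (App. C 2) p. 164), *"the measure P, conditioned to the fixed values z̄ will then factorize
“over the boxes □”"* (p. 153), the tower identity behind (5.13) p. 155 and the two-stage conditioning of p. 159 — were proved in the tree for
the free field (1.1) only (`…Markov` §6, `…Disintegration`, `…CondLaw`, `…TwoStageLaw` §B, `…Sect5Eq515.condField_ae_eqOn`).  Here they
are proved for the Gaussian field `gaussianFieldOfKernel K` of an ARBITRARY positive-semidefinite kernel `K` on `Q₀` with invertible Gram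
matrices on the conditioning sets, the conditioned field being the tree's regression recipe
`(gaussianFieldOfKernel (condCov K C)).map (ζ ↦ u_C(z̄) + ζ)` (no new definition: at `K = freeCov d α β` this expression IS
`B1Eq324BenfattoLemma.condField d α β C z̄` by `rfl`, recorded in the tree as `…Sect5SlotMoments.condField_eq_map`).  The MARKOV input is decoupled from the lattice: independence of the box
fields is derived from the HYPOTHESIS that `C^Γ` vanishes across the regions (for the free field that hypothesis is
`…Markov.condCov_freeCov_eq_zero_of_enclosed`; for a finite-range precision it is block structure — not this file).

WHAT IS PROVED (standard axioms; no `sorry`; no definition).  `K` positive semidefinite, `C, Γ ⊂ Q₀` finite with `K_CC` invertible,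
`P̄^K_{C,z̄} := (gaussianFieldOfKernel (condCov K C)).map (ζ ↦ condMean K C z̄ + ζ)`.
* §1 `P̄^K_{C,z̄}` AS A MEASURE: `condFieldK_empty` (at `C = ∅` it is `𝒩(0,K)` itself), `isProbabilityMeasure_condFieldK`,
  ★ `isGaussianProcess_condFieldK`, `integral_eval_condFieldK` (centre `u_C(z̄)`), `covariance_eval_condFieldK` (covariance `C^C`),
  `condFieldK_ae_eqOn` (`z = z̄` on `C` a.s.).
* §2 ★★ `indepFun_condFieldK_of_condCov_eq_zero` / ★★ `iIndepFun_condFieldK_of_condCov_eq_zero` — FACTORISATION «over the boxes»: coordinate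
  families of regions across which `C^C` vanishes are (mutually) independent under `P̄^K_{C,z̄}` (jointly Gaussian, Mathlib's
  `IsGaussianProcess.(i)IndepFun_of_covariance_eq_zero`).
* §3 ★★ `integral_eq_integral_condFieldK` — THE TOWER IDENTITY `∫ F d𝒩(0,K) = ∫ (∫ F dP̄^K_{C,z̄}) d𝒩(0,K)(z̄)` for integrable `F`
  (coupling `…TwoStageLaw.map_coupling_eq`); ★★ `integral_prod_eq_integral_prod_condFieldK` — (5.13) AS PRINTED for the class:
  `∫ Π_i f_i(z|_{Ω_i}) d𝒩(0,K) = ∫ [Π_i ∫ f_i dP̄^K_{C,z̄}] d𝒩(0,K)(z̄)` for pairwise `C^C`-decoupled regions.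
* §4 ★★★ `integral_condFieldK_eq_integral_condFieldK_union` — TWO-STAGE CONDITIONING, THE DISINTEGRATION, for the class: for `K_{(C∪Γ)(C∪Γ)}`
  positive definite, `Γ ∩ C = ∅`, data `z̄` and bounded measurable `g`,
  `∫ g(ξ|_Γ, ξ) dP̄^K_{C,z̄}(ξ) = ∫ (∫ g(ξ|_Γ, z) dP̄^K_{C∪Γ,ξ}(z)) dP̄^K_{C,z̄}(ξ)` (§A of `…TwoStageLaw` for the kernel `C^C` +
  n08-c's `…CondKernelGeneric.condCov_union_eq_of_posDef` / `condMean_union_eq_of_posDef`).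
HONEST SCOPE.  Kernel-generic Gaussian conditioning on the lattice `Q₀`; the class HYPOTHESES of a generalised Basic Lemma (which `K`, which
vanishing of `C^Γ`, which decay) and that lemma are NOT stated or proved here; nothing of [Balaban1985UV3] / [Balaban1985UV2] is asserted;
count-neutral for N08; nothing about d = 4, the continuum, OS axioms, a mass gap or the Clay problem.
-/

noncomputable section

open MeasureTheory ProbabilityTheory Finset Matrix
open scoped BigOperators Matrix NNReal ENNReal

namespace Literature.MathematicalPhysics.QuantumFieldTheory.Balaban1983to89.B1Eq324BenfattoKernelCondField

open Literature.MathematicalPhysics.QuantumFieldTheory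
open Literature.MathematicalPhysics.QuantumFieldTheory.Balaban1983to89.B1Eq324BenfattoLemma
open Literature.MathematicalPhysics.QuantumFieldTheory.Balaban1983to89.B1Eq324BenfattoCondCentre
open Literature.MathematicalPhysics.QuantumFieldTheory.Balaban1983to89.B1Eq324BenfattoMarkov
open Literature.MathematicalPhysics.QuantumFieldTheory.Balaban1983to89.B1Eq324BenfattoKernelRegression
open Literature.MathematicalPhysics.QuantumFieldTheory.Balaban1983to89.B1Eq324BenfattoCondKernelGeneric
open Literature.MathematicalPhysics.QuantumFieldTheory.Balaban1983to89.B1Eq324BenfattoTwoStageLaw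

variable {d : ℕ}

/-! ## §1  The conditioned field of a general kernel as a measure -/

section Field

variable {K : B1Eq324BenfattoLemma.Site d → B1Eq324BenfattoLemma.Site d → ℝ} (hKp : IsPosSemidefKernel K)
  (C : Finset (B1Eq324BenfattoLemma.Site d)) (hC : IsUnit (covGram K C).det)

/-- kernel: the shift `ζ ↦ u + ζ` by a fixed configuration is measurable. [folklore] -/
private theorem measurable_shift (u : B1Eq324BenfattoLemma.Site d → ℝ) :
    Measurable fun (ζ : B1Eq324BenfattoLemma.Site d → ℝ) (x : B1Eq324BenfattoLemma.Site d) => u x + ζ x :=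
  measurable_pi_lambda _ fun x => measurable_const.add (measurable_pi_apply x)

/-- **At `C = ∅` the conditioned field of `K` IS the Gaussian field of `K`** (`condCov K ∅ = K`, `condMean K ∅ = 0`) — so the measure of
(4.6) at `C = ∅` is the measure of (4.7), for the class (the `freeCov` instance is `B1Eq324BenfattoLemma.condField_empty`).
[cite: BenfattoEtAl1978, (4.6)–(4.7) p.152 «if C = ∅»] -/
theorem condFieldK_empty (K : B1Eq324BenfattoLemma.Site d → B1Eq324BenfattoLemma.Site d → ℝ) (zbar : B1Eq324BenfattoLemma.Site d → ℝ) :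
    (gaussianFieldOfKernel (condCov K ∅)).map
        (fun (ζ : B1Eq324BenfattoLemma.Site d → ℝ) (x : B1Eq324BenfattoLemma.Site d) => condMean K ∅ zbar x + ζ x) =
      gaussianFieldOfKernel K := by
  have hshift : (fun (ζ : B1Eq324BenfattoLemma.Site d → ℝ) (x : B1Eq324BenfattoLemma.Site d) => condMean K ∅ zbar x + ζ x) = id := by
    funext ζ x
    rw [condMean_empty, zero_add, id]
  rw [hshift, Measure.map_id, condCov_empty]

include hKp hC

/-- **`P̄^K_{C,z̄}` is a probability measure** (`C^C` is positive semidefinite: `…KernelRegression.isPosSemidefKernel_condCov`).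
[cite: BenfattoEtAl1978, p.152 «the conditional distribution P̂₀(dz|(z̄_Δ)_{Δ∈C})»] -/
theorem isProbabilityMeasure_condFieldK (zbar : B1Eq324BenfattoLemma.Site d → ℝ) :
    IsProbabilityMeasure ((gaussianFieldOfKernel (condCov K C)).map
      fun (ζ : B1Eq324BenfattoLemma.Site d → ℝ) (x : B1Eq324BenfattoLemma.Site d) => condMean K C zbar x + ζ x) := by
  haveI := isProbabilityMeasure_gaussianFieldOfKernel (isPosSemidefKernel_condCov K hKp C hC)
  exact Measure.isProbabilityMeasure_map (measurable_shift _).aemeasurable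

/-- **Under `P̄^K_{C,z̄}` the coordinates form a (non-centred) GAUSSIAN FIELD** — p. 164 *"the conditioned variables (z_Δ)_{Δ∉Γ} are a non
centered gaussian field"*, for the class. [cite: BenfattoEtAl1978, Appendix C 2) p.164] -/
theorem isGaussianProcess_condFieldK (zbar : B1Eq324BenfattoLemma.Site d → ℝ) :
    IsGaussianProcess (fun (x : B1Eq324BenfattoLemma.Site d) (z : B1Eq324BenfattoLemma.Site d → ℝ) => z x)
      ((gaussianFieldOfKernel (condCov K C)).map
        fun (ζ : B1Eq324BenfattoLemma.Site d → ℝ) (x : B1Eq324BenfattoLemma.Site d) => condMean K C zbar x + ζ x) := by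
  classical
  have hKc := isPosSemidefKernel_condCov K hKp C hC
  set Q := gaussianFieldOfKernel (condCov K C) with hQ
  haveI := isProbabilityMeasure_gaussianFieldOfKernel hKc
  set u : B1Eq324BenfattoLemma.Site d → ℝ := condMean K C zbar with hu
  set T : (B1Eq324BenfattoLemma.Site d → ℝ) → (B1Eq324BenfattoLemma.Site d → ℝ) := fun ζ x => u x + ζ x with hT
  have hTm : Measurable T := measurable_shift u
  change IsGaussianProcess _ (Q.map T)
  refine ⟨fun I => ?_⟩
  have hG : HasGaussianLaw (fun ζ : B1Eq324BenfattoLemma.Site d → ℝ => I.restrict ζ) Q :=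
    (isGaussianProcess_eval_gaussianFieldOfKernel hKc).hasGaussianLaw I
  have hrm : Measurable (fun z : B1Eq324BenfattoLemma.Site d → ℝ => I.restrict z) := Finset.measurable_restrict I
  have hcomp : (fun z : B1Eq324BenfattoLemma.Site d → ℝ => I.restrict z) ∘ T =
      (fun v : I → ℝ => I.restrict u + v) ∘ fun ζ => I.restrict ζ := by
    funext ζ
    ext i
    simp only [Function.comp_apply, Finset.restrict, hT, Pi.add_apply]
  have hshift : Measurable fun v : I → ℝ => I.restrict u + v := measurable_const.add measurable_id
  refine ⟨?_⟩
  rw [Measure.map_map hrm hTm]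
  change IsGaussian (Q.map ((fun z : B1Eq324BenfattoLemma.Site d → ℝ => I.restrict z) ∘ T))
  rw [hcomp, ← Measure.map_map hshift hrm]
  haveI : IsGaussian (Q.map fun ζ : B1Eq324BenfattoLemma.Site d → ℝ => I.restrict ζ) := hG.isGaussian_map
  infer_instance

/-- **The centre of `P̄^K_{C,z̄}` is the regression mean**: `∫ z_x dP̄ = u_C(z̄)(x)` — p. 164 «center u_Δ», for the class.
[cite: BenfattoEtAl1978, Appendix C 2) (C.7) p.164] -/
theorem integral_eval_condFieldK (zbar : B1Eq324BenfattoLemma.Site d → ℝ) (x : B1Eq324BenfattoLemma.Site d) :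
    ∫ z, z x ∂((gaussianFieldOfKernel (condCov K C)).map
        fun (ζ : B1Eq324BenfattoLemma.Site d → ℝ) (x : B1Eq324BenfattoLemma.Site d) => condMean K C zbar x + ζ x) =
      condMean K C zbar x := by
  have hKc := isPosSemidefKernel_condCov K hKp C hC
  set Q := gaussianFieldOfKernel (condCov K C) with hQ
  haveI := isProbabilityMeasure_gaussianFieldOfKernel hKc
  set u : B1Eq324BenfattoLemma.Site d → ℝ := condMean K C zbar with hu
  set T : (B1Eq324BenfattoLemma.Site d → ℝ) → (B1Eq324BenfattoLemma.Site d → ℝ) := fun ζ x => u x + ζ x with hT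
  have hTm : Measurable T := measurable_shift u
  change ∫ z, z x ∂(Q.map T) = u x
  rw [integral_map hTm.aemeasurable (measurable_pi_apply x).aestronglyMeasurable]
  have hint : Integrable (fun ζ : B1Eq324BenfattoLemma.Site d → ℝ => ζ x) Q :=
    ((isGaussianProcess_eval_gaussianFieldOfKernel hKc).hasGaussianLaw_eval x).integrable
  change ∫ ζ, (u x + ζ x) ∂Q = u x
  rw [integral_add (integrable_const _) hint, integral_const, integral_eval_gaussianFieldOfKernel hKc x, add_zero,
    probReal_univ, one_smul]

/-- **The covariance of `P̄^K_{C,z̄}` is the Dirichlet covariance `C^C`**: `Cov_P̄(z_x, z_y) = condCov K C x y` — p. 164 «with covariance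
C^Γ_{ΔΔ′}», for the class. [cite: BenfattoEtAl1978, Appendix C 2) (C.6) p.164] -/
theorem covariance_eval_condFieldK (zbar : B1Eq324BenfattoLemma.Site d → ℝ) (x y : B1Eq324BenfattoLemma.Site d) :
    cov[fun z => z x, fun z => z y; (gaussianFieldOfKernel (condCov K C)).map
        fun (ζ : B1Eq324BenfattoLemma.Site d → ℝ) (x : B1Eq324BenfattoLemma.Site d) => condMean K C zbar x + ζ x] =
      condCov K C x y := by
  have hKc := isPosSemidefKernel_condCov K hKp C hC
  set Q := gaussianFieldOfKernel (condCov K C) with hQ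
  haveI := isProbabilityMeasure_gaussianFieldOfKernel hKc
  set u : B1Eq324BenfattoLemma.Site d → ℝ := condMean K C zbar with hu
  set T : (B1Eq324BenfattoLemma.Site d → ℝ) → (B1Eq324BenfattoLemma.Site d → ℝ) := fun ζ x => u x + ζ x with hT
  have hTm : Measurable T := measurable_shift u
  change cov[fun z => z x, fun z => z y; Q.map T] = _
  rw [covariance_map (measurable_pi_apply x).aestronglyMeasurable (measurable_pi_apply y).aestronglyMeasurable hTm.aemeasurable]
  have hix : Integrable (fun ζ : B1Eq324BenfattoLemma.Site d → ℝ => ζ x) Q :=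
    ((isGaussianProcess_eval_gaussianFieldOfKernel hKc).hasGaussianLaw_eval x).integrable
  have hiy : Integrable (fun ζ : B1Eq324BenfattoLemma.Site d → ℝ => ζ y) Q :=
    ((isGaussianProcess_eval_gaussianFieldOfKernel hKc).hasGaussianLaw_eval y).integrable
  change cov[fun ζ => u x + ζ x, fun ζ => u y + ζ y; Q] = _
  rw [covariance_const_add_left hix, covariance_const_add_right hiy, covariance_eval_gaussianFieldOfKernel hKc x y]

/-- **On `C` the conditioned field IS the datum, almost surely**: `z_c = z̄_c` for all `c ∈ C`, `P̄^K_{C,z̄}`-a.s. (the Schur field has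
variance `C^C_cc = 0` on `C` and the centre reproduces `z̄` there). [cite: BenfattoEtAl1978, p.152 «P̂₀(dz|(z̄_Δ)_{Δ∈C})»; Appendix C 2) (C.7) p.164] -/
theorem condFieldK_ae_eqOn (zbar : B1Eq324BenfattoLemma.Site d → ℝ) :
    ∀ᵐ z ∂((gaussianFieldOfKernel (condCov K C)).map
        fun (ζ : B1Eq324BenfattoLemma.Site d → ℝ) (x : B1Eq324BenfattoLemma.Site d) => condMean K C zbar x + ζ x),
      ∀ c ∈ C, z c = zbar c := by
  have hKc := isPosSemidefKernel_condCov K hKp C hC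
  set Q := gaussianFieldOfKernel (condCov K C) with hQ
  set T : (B1Eq324BenfattoLemma.Site d → ℝ) → (B1Eq324BenfattoLemma.Site d → ℝ) :=
    fun ζ x => condMean K C zbar x + ζ x with hT
  have hTm : Measurable T := measurable_shift _
  change ∀ᵐ z ∂(Q.map T), ∀ c ∈ C, z c = zbar c
  rw [ae_map_iff hTm.aemeasurable]
  · have hall : ∀ c ∈ C, ∀ᵐ ζ ∂Q, T ζ c = zbar c := by
      intro c hc
      filter_upwards [schurField_eval_ae_eq_zero C hC hKc hc] with ζ hζ
      simp only [hT, hζ, add_zero]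
      exact condMean_apply_of_mem K C zbar hC hc
    exact (ae_ball_iff (Finset.countable_toSet C)).2 hall
  · have hset : {z : B1Eq324BenfattoLemma.Site d → ℝ | ∀ c ∈ C, z c = zbar c} =
        ⋂ c ∈ (C : Set (B1Eq324BenfattoLemma.Site d)), {z : B1Eq324BenfattoLemma.Site d → ℝ | z c = zbar c} := by
      ext z
      simp only [Set.mem_setOf_eq, Set.mem_iInter, Finset.mem_coe]
    rw [hset]
    exact MeasurableSet.biInter (Finset.countable_toSet C) fun c _ =>
      measurableSet_eq_fun (measurable_pi_apply (X := fun _ : B1Eq324BenfattoLemma.Site d => ℝ) c) measurable_const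

/-! ## §2  Factorisation «over the boxes»: independence where `C^C` vanishes -/

/-- **INDEPENDENCE ACROSS A `C^C`-DECOUPLED REGION**: if `condCov K C s t = 0` for all `s ∈ Ω`, `t ∉ Ω`, then under `P̄^K_{C,z̄}` the
family `(z_x)_{x∈Ω}` is independent of `(z_y)_{y∉Ω}` (jointly Gaussian with vanishing cross-covariances) — the Markov factorisation of
p. 153/p. 155 with its lattice input isolated as a hypothesis (for the free field and a `Γ`-enclosed `Ω` that hypothesis is
`…Markov.condCov_freeCov_eq_zero_of_enclosed`). [cite: BenfattoEtAl1978, §5 (5.13) p.155; p.153] -/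
theorem indepFun_condFieldK_of_condCov_eq_zero {Ω : Set (B1Eq324BenfattoLemma.Site d)}
    (hvan : ∀ s ∈ Ω, ∀ t ∉ Ω, condCov K C s t = 0) (zbar : B1Eq324BenfattoLemma.Site d → ℝ) :
    IndepFun (fun (z : B1Eq324BenfattoLemma.Site d → ℝ) (s : Ω) => z s)
      (fun (z : B1Eq324BenfattoLemma.Site d → ℝ) (t : ↥Ωᶜ) => z t)
      ((gaussianFieldOfKernel (condCov K C)).map
        fun (ζ : B1Eq324BenfattoLemma.Site d → ℝ) (x : B1Eq324BenfattoLemma.Site d) => condMean K C zbar x + ζ x) := by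
  have hG := isGaussianProcess_condFieldK hKp C hC zbar
  set P := (gaussianFieldOfKernel (condCov K C)).map
        fun (ζ : B1Eq324BenfattoLemma.Site d → ℝ) (x : B1Eq324BenfattoLemma.Site d) => condMean K C zbar x + ζ x with hP
  have hXY : IsGaussianProcess (Sum.elim (fun (s : Ω) (z : B1Eq324BenfattoLemma.Site d → ℝ) => z s)
      (fun (t : ↥Ωᶜ) (z : B1Eq324BenfattoLemma.Site d → ℝ) => z t)) P := by
    have h := hG.comp_right (Sum.elim (fun s : Ω => (s : B1Eq324BenfattoLemma.Site d)) (fun t : ↥Ωᶜ => (t : B1Eq324BenfattoLemma.Site d)))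
    have he : (fun (x : B1Eq324BenfattoLemma.Site d) (z : B1Eq324BenfattoLemma.Site d → ℝ) => z x) ∘
        Sum.elim (fun s : Ω => (s : B1Eq324BenfattoLemma.Site d)) (fun t : ↥Ωᶜ => (t : B1Eq324BenfattoLemma.Site d))
        = Sum.elim (fun (s : Ω) (z : B1Eq324BenfattoLemma.Site d → ℝ) => z s)
          (fun (t : ↥Ωᶜ) (z : B1Eq324BenfattoLemma.Site d → ℝ) => z t) := by
      funext i
      cases i <;> rfl
    rwa [he] at h
  refine hXY.indepFun_of_covariance_eq_zero (fun s => (measurable_pi_apply _).aemeasurable)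
    (fun t => (measurable_pi_apply _).aemeasurable) fun s t => ?_
  rw [hP, covariance_eval_condFieldK hKp C hC zbar]
  exact hvan s s.2 t t.2

/-- **MUTUAL INDEPENDENCE OF PAIRWISE `C^C`-DECOUPLED REGIONS** — (5.13)'s factorisation for the class: for a family of regions `Ω_i`
with `condCov K C s t = 0` whenever `s ∈ Ω_i`, `t ∈ Ω_j`, `i ≠ j`, the coordinate families `((z_x)_{x∈Ω_i})_i` are mutually independent
under `P̄^K_{C,z̄}` («the measure P, conditioned to the fixed values z̄ will then factorize “over the boxes □”», p. 153).
[cite: BenfattoEtAl1978, §5 (5.13) p.155; p.153] -/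
theorem iIndepFun_condFieldK_of_condCov_eq_zero {ι : Type*} {Ω : ι → Set (B1Eq324BenfattoLemma.Site d)}
    (hvan : ∀ i j, i ≠ j → ∀ s ∈ Ω i, ∀ t ∈ Ω j, condCov K C s t = 0) (zbar : B1Eq324BenfattoLemma.Site d → ℝ) :
    iIndepFun (fun i (z : B1Eq324BenfattoLemma.Site d → ℝ) (s : Ω i) => z s)
      ((gaussianFieldOfKernel (condCov K C)).map
        fun (ζ : B1Eq324BenfattoLemma.Site d → ℝ) (x : B1Eq324BenfattoLemma.Site d) => condMean K C zbar x + ζ x) := by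
  have hG := isGaussianProcess_condFieldK hKp C hC zbar
  set P := (gaussianFieldOfKernel (condCov K C)).map
        fun (ζ : B1Eq324BenfattoLemma.Site d → ℝ) (x : B1Eq324BenfattoLemma.Site d) => condMean K C zbar x + ζ x with hP
  have hX : IsGaussianProcess (fun (p : (i : ι) × Ω i) (z : B1Eq324BenfattoLemma.Site d → ℝ) => z (p.2 : B1Eq324BenfattoLemma.Site d)) P :=
    hG.comp_right (fun p : (i : ι) × Ω i => (p.2 : B1Eq324BenfattoLemma.Site d))
  refine IsGaussianProcess.iIndepFun_of_covariance_eq_zero (X := fun i (s : Ω i) (z : B1Eq324BenfattoLemma.Site d → ℝ) => z s) hX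
    (fun i s => (measurable_pi_apply _).aemeasurable) fun i j hij s t => ?_
  rw [hP, covariance_eval_condFieldK hKp C hC zbar]
  exact hvan i j hij s s.2 t t.2

/-! ## §3  The tower identity and (5.13) for the class -/

/-- **THE TOWER IDENTITY `∫ F d𝒩(0,K) = ∫ (∫ F dP̄^K_{C,z̄}) d𝒩(0,K)(z̄)`** for every measurable, `𝒩(0,K)`-integrable `F`: the regression-defined
conditioned field IS a version of the conditional law of the Gaussian field of `K` given `z_C` (coupling `W(z̄, ζ) = u_C(z̄) + ζ` on
`𝒩(0,K) ⊗ 𝒩(0,C^C)` has law `𝒩(0,K)`: `…TwoStageLaw.map_coupling_eq`; Fubini) — (5.13)'s «∫ P(dz_{Γ₁}) ∫ … P(dz_□̃|z_{Γ₁})» for the class.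
[cite: BenfattoEtAl1978, §5 (5.13) p.155; p.152] -/
theorem integral_eq_integral_condFieldK {F : (B1Eq324BenfattoLemma.Site d → ℝ) → ℝ} (hFm : Measurable F)
    (hFi : Integrable F (gaussianFieldOfKernel K)) :
    ∫ z, F z ∂gaussianFieldOfKernel K =
      ∫ zbar, (∫ z, F z ∂((gaussianFieldOfKernel (condCov K C)).map
        fun (ζ : B1Eq324BenfattoLemma.Site d → ℝ) (x : B1Eq324BenfattoLemma.Site d) => condMean K C zbar x + ζ x))
        ∂gaussianFieldOfKernel K := by
  have hKc := isPosSemidefKernel_condCov K hKp C hC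
  set μ := gaussianFieldOfKernel K with hμ
  set Q := gaussianFieldOfKernel (condCov K C) with hQ
  haveI : IsProbabilityMeasure μ := isProbabilityMeasure_gaussianFieldOfKernel hKp
  haveI : IsProbabilityMeasure Q := isProbabilityMeasure_gaussianFieldOfKernel hKc
  set T : (B1Eq324BenfattoLemma.Site d → ℝ) × (B1Eq324BenfattoLemma.Site d → ℝ) → (B1Eq324BenfattoLemma.Site d → ℝ) :=
    fun p x => condMean K C p.1 x + p.2 x with hT
  have hum : ∀ x, Measurable fun z : B1Eq324BenfattoLemma.Site d → ℝ => condMean K C z x := by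
    intro x
    simp only [condMean]
    refine Finset.measurable_sum _ fun c _ => Finset.measurable_sum _ fun c' _ => ?_
    exact (measurable_const.mul (measurable_pi_apply _))
  have hTm : Measurable T :=
    measurable_pi_lambda _ fun x => ((hum x).comp measurable_fst).add ((measurable_pi_apply x).comp measurable_snd)
  have hP : μ = (μ.prod Q).map T := (map_coupling_eq hKp C hC hKc).symm
  have h1 : ∫ z, F z ∂μ = ∫ p, F (T p) ∂μ.prod Q := by
    conv_lhs => rw [hP]
    rw [integral_map hTm.aemeasurable hFm.aestronglyMeasurable]
  have hFi' : Integrable (fun p => F (T p)) (μ.prod Q) :=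
    (integrable_map_measure hFm.aestronglyMeasurable hTm.aemeasurable).mp (by rw [← hP]; exact hFi)
  rw [h1, integral_prod _ hFi']
  refine integral_congr_ae (Filter.Eventually.of_forall fun zbar => ?_)
  have hTz : Measurable fun ζ : B1Eq324BenfattoLemma.Site d → ℝ => T (zbar, ζ) := hTm.comp (measurable_const.prodMk measurable_id)
  change ∫ ζ, F (T (zbar, ζ)) ∂Q = ∫ z, F z ∂(Q.map fun ζ : B1Eq324BenfattoLemma.Site d → ℝ => T (zbar, ζ))
  rw [integral_map hTz.aemeasurable hFm.aestronglyMeasurable]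

/-- **(5.13) FOR THE CLASS — CONDITIONING FACTORIZES THE INTEGRAL OVER DECOUPLED REGIONS**: for finitely many regions `Ω_i`, pairwise
`C^C`-decoupled (`condCov K C s t = 0` across distinct regions), and observables `f_i` of the field in `Ω_i`,
`∫ Π_i f_i(z|_{Ω_i}) d𝒩(0,K) = ∫ [Π_i ∫ f_i(z|_{Ω_i}) dP̄^K_{C,z̄}] d𝒩(0,K)(z̄)` (tower identity + §2).
[cite: BenfattoEtAl1978, §5 (5.13) p.155] -/
theorem integral_prod_eq_integral_prod_condFieldK {ι : Type*} [Fintype ι] {Ω : ι → Set (B1Eq324BenfattoLemma.Site d)}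
    (hvan : ∀ i j, i ≠ j → ∀ s ∈ Ω i, ∀ t ∈ Ω j, condCov K C s t = 0)
    (f : (i : ι) → ((Ω i) → ℝ) → ℝ) (hf : ∀ i, Measurable (f i))
    (hint : Integrable (fun z : B1Eq324BenfattoLemma.Site d → ℝ => ∏ i, f i (fun s : Ω i => z s)) (gaussianFieldOfKernel K)) :
    ∫ z, ∏ i, f i (fun s : Ω i => z s) ∂gaussianFieldOfKernel K
      = ∫ zbar, ∏ i, (∫ z, f i (fun s : Ω i => z s) ∂((gaussianFieldOfKernel (condCov K C)).map
          fun (ζ : B1Eq324BenfattoLemma.Site d → ℝ) (x : B1Eq324BenfattoLemma.Site d) => condMean K C zbar x + ζ x))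
        ∂gaussianFieldOfKernel K := by
  have hXm : ∀ i, Measurable fun (z : B1Eq324BenfattoLemma.Site d → ℝ) (s : Ω i) => z s :=
    fun i => measurable_pi_lambda _ fun s => measurable_pi_apply _
  have hFm : Measurable fun z : B1Eq324BenfattoLemma.Site d → ℝ => ∏ i, f i (fun s : Ω i => z s) :=
    Finset.measurable_prod _ fun i _ => (hf i).comp (hXm i)
  rw [integral_eq_integral_condFieldK hKp C hC hFm hint]
  refine integral_congr_ae (Filter.Eventually.of_forall fun zbar => ?_)
  exact (iIndepFun_condFieldK_of_condCov_eq_zero hKp C hC hvan zbar).integral_fun_prod_comp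
    (fun i => (hXm i).aemeasurable) fun i => (hf i).aestronglyMeasurable

end Field

/-! ## §4  Two-stage conditioning, the disintegration, for the class -/

section TwoStage

variable {K : B1Eq324BenfattoLemma.Site d → B1Eq324BenfattoLemma.Site d → ℝ} (hKp : IsPosSemidefKernel K)

include hKp

/-- **`P̄^K_{C,z̄}(· | z_Γ) = P̄^K_{C∪Γ,·}` — TWO-STAGE CONDITIONING, THE DISINTEGRATION, for a general kernel.**  For `K` positive semidefinite with
`K_{(C∪Γ)(C∪Γ)}` positive definite, `Γ ∩ C = ∅`, data `z̄` and every bounded measurable `g : (Γ → ℝ) × (Q₀ → ℝ) → ℝ`: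
`∫ g(ξ|_Γ, ξ) dP̄^K_{C,z̄}(ξ) = ∫ ( ∫ g(ξ|_Γ, z) dP̄^K_{C∪Γ,ξ}(z) ) dP̄^K_{C,z̄}(ξ)` — `ξ ↦ P̄^K_{C∪Γ,ξ}` (reading `ξ` on `C ∪ Γ`; `ξ = z̄` on `C`
a.s.) is a conditional law of `P̄^K_{C,z̄}` given the `Γ`-coordinates: the conditioning of p. 159 («We start from (5.13)» with `P̄ = P̂₀(·|z̄_C)`
and the corridor variables fixed) for the class.  Proof = `…TwoStageLaw` §B with the free-field inputs replaced by
`…KernelRegression.isPosSemidefKernel_condCov` and n08-c's `…CondKernelGeneric.isUnit_det_covGram_condCov_of_posDef` /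
`condCov_union_eq_of_posDef` / `condMean_union_eq_of_posDef`.
[cite: BenfattoEtAl1978, p.152 «P̄(dz) = P̂₀(dz|(z̄_Δ)_{Δ∈C})», §5 (5.13) p.155, (5.36) p.159; Appendix C 2) p.164] -/
theorem integral_condFieldK_eq_integral_condFieldK_union (C Γ : Finset (B1Eq324BenfattoLemma.Site d)) (hdisj : Disjoint Γ C)
    (hE : (covGram K (C ∪ Γ)).PosDef) (zbar : B1Eq324BenfattoLemma.Site d → ℝ)
    {g : (Γ → ℝ) × (B1Eq324BenfattoLemma.Site d → ℝ) → ℝ} (hg : Measurable g) {M : ℝ} (hM : ∀ z, |g z| ≤ M) :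
    ∫ ξ, g (Γ.restrict ξ, ξ) ∂((gaussianFieldOfKernel (condCov K C)).map
        fun (ζ : B1Eq324BenfattoLemma.Site d → ℝ) (x : B1Eq324BenfattoLemma.Site d) => condMean K C zbar x + ζ x) =
      ∫ ξ, (∫ z, g (Γ.restrict ξ, z) ∂((gaussianFieldOfKernel (condCov K (C ∪ Γ))).map
          fun (ζ : B1Eq324BenfattoLemma.Site d → ℝ) (x : B1Eq324BenfattoLemma.Site d) => condMean K (C ∪ Γ) ξ x + ζ x))
        ∂((gaussianFieldOfKernel (condCov K C)).map
          fun (ζ : B1Eq324BenfattoLemma.Site d → ℝ) (x : B1Eq324BenfattoLemma.Site d) => condMean K C zbar x + ζ x) := by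
  have hdetK : IsUnit (covGram K C).det :=
    (Matrix.isUnit_iff_isUnit_det _).mp (posDef_covGram_of_subset Finset.subset_union_left hE).isUnit
  have hdetE : IsUnit (covGram K (C ∪ Γ)).det := (Matrix.isUnit_iff_isUnit_det _).mp hE.isUnit
  set KC := condCov K C with hKC
  have hKCpsd : IsPosSemidefKernel KC := isPosSemidefKernel_condCov K hKp C hdetK
  have hdetC : IsUnit (covGram KC Γ).det := isUnit_det_covGram_condCov_of_posDef C Γ hdisj hE
  -- `condCov C^C Γ = C^{C∪Γ}` (n08-c's two-stage identity), hence positive-semidefinite, and the two Schur fields coincide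
  have hcc : condCov KC Γ = condCov K (C ∪ Γ) := by
    funext x y
    exact (condCov_union_eq_of_posDef C Γ hdisj hE x y).symm
  have hKCc : IsPosSemidefKernel (condCov KC Γ) := by
    rw [hcc]
    exact isPosSemidefKernel_condCov K hKp (C ∪ Γ) hdetE
  set QC := gaussianFieldOfKernel KC with hQC
  set Q2 := gaussianFieldOfKernel (condCov KC Γ) with hQ2
  haveI : IsProbabilityMeasure QC := isProbabilityMeasure_gaussianFieldOfKernel hKCpsd
  haveI : IsProbabilityMeasure Q2 := isProbabilityMeasure_gaussianFieldOfKernel hKCc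
  -- the centre and the shift
  set u : B1Eq324BenfattoLemma.Site d → ℝ := condMean K C zbar with hu
  set T : (B1Eq324BenfattoLemma.Site d → ℝ) → (B1Eq324BenfattoLemma.Site d → ℝ) := fun ζ x => u x + ζ x with hT
  have hTm : Measurable T := measurable_pi_lambda _ fun x => (measurable_pi_apply x).const_add _
  have hres : Measurable fun ξ : B1Eq324BenfattoLemma.Site d → ℝ => Γ.restrict ξ := Finset.measurable_restrict Γ
  have hG : Measurable fun z : B1Eq324BenfattoLemma.Site d → ℝ => g (Γ.restrict z, z) := hg.comp (hres.prodMk measurable_id)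
  -- LHS on `QC`
  change ∫ ξ, g (Γ.restrict ξ, ξ) ∂(QC.map T) = ∫ ξ, (∫ z, g (Γ.restrict ξ, z) ∂((gaussianFieldOfKernel (condCov K (C ∪ Γ))).map
          fun (ζ : B1Eq324BenfattoLemma.Site d → ℝ) (x : B1Eq324BenfattoLemma.Site d) => condMean K (C ∪ Γ) ξ x + ζ x)) ∂(QC.map T)
  rw [integral_map hTm.aemeasurable hG.aestronglyMeasurable]
  -- the shifted observable `g'(r, z) = g(u|_Γ + r, T z)`
  set g' : (Γ → ℝ) × (B1Eq324BenfattoLemma.Site d → ℝ) → ℝ := fun p => g (fun γ => u γ + p.1 γ, T p.2) with hg'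
  have hg'm : Measurable g' := by
    refine hg.comp (Measurable.prodMk ?_ (hTm.comp measurable_snd))
    exact measurable_pi_lambda _ fun γ => ((measurable_pi_apply γ).comp measurable_fst).const_add _
  have hg'M : ∀ p, |g' p| ≤ M := fun p => hM _
  have hLHS : ∀ ζ : B1Eq324BenfattoLemma.Site d → ℝ, g (Γ.restrict (T ζ), T ζ) = g' (Γ.restrict ζ, ζ) := fun ζ => rfl
  simp_rw [hLHS]
  rw [integral_gaussianFieldOfKernel_eq_condLaw hKCpsd Γ hdetC hKCc hg'm hg'M]
  -- RHS on `QC`: the integrand `ξ ↦ ∫ g(ξ|_Γ, z) dP̄^K_{C∪Γ,ξ}` is measurable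
  set Q3 := gaussianFieldOfKernel (condCov K (C ∪ Γ)) with hQ3
  have hQ23 : Q2 = Q3 := by rw [hQ2, hQ3, hcc]
  haveI : IsProbabilityMeasure Q3 := hQ23 ▸ inferInstance
  have hum : ∀ x, Measurable fun ξ : B1Eq324BenfattoLemma.Site d → ℝ => condMean K (C ∪ Γ) ξ x := by
    intro x
    simp only [condMean]
    fun_prop
  set W3 : (B1Eq324BenfattoLemma.Site d → ℝ) × (B1Eq324BenfattoLemma.Site d → ℝ) → (B1Eq324BenfattoLemma.Site d → ℝ) :=
    fun p x => condMean K (C ∪ Γ) p.1 x + p.2 x with hW3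
  have hW3m : Measurable W3 :=
    measurable_pi_lambda _ fun x => ((hum x).comp measurable_fst).add ((measurable_pi_apply x).comp measurable_snd)
  have hF : ∀ ξ : B1Eq324BenfattoLemma.Site d → ℝ,
      ∫ z, g (Γ.restrict ξ, z) ∂((gaussianFieldOfKernel (condCov K (C ∪ Γ))).map
          fun (ζ : B1Eq324BenfattoLemma.Site d → ℝ) (x : B1Eq324BenfattoLemma.Site d) => condMean K (C ∪ Γ) ξ x + ζ x) =
        ∫ ζ', g (Γ.restrict ξ, W3 (ξ, ζ')) ∂Q3 := by
    intro ξ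
    have hcf3 : ((gaussianFieldOfKernel (condCov K (C ∪ Γ))).map
          fun (ζ : B1Eq324BenfattoLemma.Site d → ℝ) (x : B1Eq324BenfattoLemma.Site d) => condMean K (C ∪ Γ) ξ x + ζ x) =
        Q3.map fun ζ' => W3 (ξ, ζ') := rfl
    have hW3ξ : Measurable fun ζ' : B1Eq324BenfattoLemma.Site d → ℝ => W3 (ξ, ζ') := hW3m.comp (measurable_const.prodMk measurable_id)
    have hgξ : Measurable fun z : B1Eq324BenfattoLemma.Site d → ℝ => g (Γ.restrict ξ, z) := hg.comp (measurable_const.prodMk measurable_id)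
    rw [hcf3, integral_map hW3ξ.aemeasurable hgξ.aestronglyMeasurable]
  have hFm : Measurable fun ξ : B1Eq324BenfattoLemma.Site d → ℝ => ∫ z, g (Γ.restrict ξ, z)
      ∂((gaussianFieldOfKernel (condCov K (C ∪ Γ))).map
          fun (ζ : B1Eq324BenfattoLemma.Site d → ℝ) (x : B1Eq324BenfattoLemma.Site d) => condMean K (C ∪ Γ) ξ x + ζ x) := by
    simp_rw [hF]
    have hjoint : Measurable fun p : (B1Eq324BenfattoLemma.Site d → ℝ) × (B1Eq324BenfattoLemma.Site d → ℝ) => g (Γ.restrict p.1, W3 p) :=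
      hg.comp ((hres.comp measurable_fst).prodMk hW3m)
    exact (hjoint.stronglyMeasurable.integral_prod_right' (ν := Q3)).measurable
  rw [integral_map hTm.aemeasurable hFm.aestronglyMeasurable]
  -- compare the two `QC`-integrands: they agree as soon as `ζ|_C = 0`, which holds a.s.
  refine integral_congr_ae ?_
  have hzeroC : ∀ᵐ ζ ∂QC, ∀ c ∈ C, ζ c = 0 :=
    (ae_ball_iff (Finset.countable_toSet C)).2 fun c hc =>
      schurField_eval_ae_eq_zero C hdetK hKCpsd hc
  filter_upwards [hzeroC] with ζ hζ
  have hφ : Measurable fun ζ₁ : B1Eq324BenfattoLemma.Site d → ℝ => fun x => condMean KC Γ ζ x + ζ₁ x :=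
    measurable_pi_lambda _ fun x => (measurable_pi_apply x).const_add _
  have hfζ : Measurable fun z : B1Eq324BenfattoLemma.Site d → ℝ => g' (Γ.restrict ζ, z) := hg'm.comp (measurable_const.prodMk measurable_id)
  rw [hF (T ζ), integral_map hφ.aemeasurable hfζ.aestronglyMeasurable, ← hQ2, hQ23]
  refine integral_congr_ae (ae_of_all _ fun ζ' => ?_)
  -- the centres agree: `u + condMean KC Γ ζ = condMean K (C∪Γ) (Tζ)`
  have hTC : ∀ c ∈ C, T ζ c = zbar c := fun c hc => by
    simp only [hT, hu]
    rw [hζ c hc, add_zero, condMean_apply_of_mem K C zbar hdetK hc]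
  have hcentre : ∀ x, u x + condMean KC Γ ζ x = condMean K (C ∪ Γ) (T ζ) x := by
    intro x
    rw [condMean_union_eq_of_posDef C Γ hdisj hE (T ζ) x]
    have h1 : condMean K C (T ζ) x = u x := by
      simp only [hu]
      exact condMean_congr K C hTC x
    have h2 : ∀ t, T ζ t - condMean K C (T ζ) t = ζ t := fun t => by
      have := condMean_congr K C hTC t
      simp only [hT] at this ⊢
      rw [this]
      simp only [hu]
      ring
    rw [h1]
    congr 1
    simp only [hKC]
    exact condMean_congr _ Γ (fun t _ => (h2 t).symm) x
  simp only [hg', hT, hW3, Finset.restrict]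
  congr 1
  refine Prod.ext rfl (funext fun x => ?_)
  have hc := hcentre x
  simp only [hT] at hc
  simp only
  rw [← hc]
  ring

end TwoStage

end Literature.MathematicalPhysics.QuantumFieldTheory.Balaban1983to89.B1Eq324BenfattoKernelCondField

end
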